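import Summits.HodgeConjecture.HodgeConjecture.Theorems.R90S9InnerFormSec146Packets          -- ★ p862341 (R90-IF-p01, (D) ED. 2′): the law-predicate `PisSlotsNotSphericalCofinite L H Ξ`
import Summits.HodgeConjecture.HodgeConjecture.Theorems.F0P3XiPacketFamilyOfRecordSCD        -- ★ the A-packet family of record `xiPacketFamilyOfRecordSCD` (`_of_split`, `_of_nonsplit`)
import Summits.HodgeConjecture.HodgeConjecture.Theorems.F0P3SqNSNonsplitConsumers             -- ★ K3♭ `eventually_not_isSupercuspidal_of_isSpherical_congr_of_nonsplit` (+ compact-centre cone: ★ `F0P3bLocalNonsplitCompactCenter`, ★ `forall_mem_center_cmLocal_eq_scalar`)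
import Summits.HodgeConjecture.HodgeConjecture.Theorems.F0P3SqIntNotSphericalNonsplitCofinite  -- ★ (SqNS♭) `squareIntegrableNotSpherical_nonsplit_cofinite` — HYPOTHESIS-FREE
import Literature.NumberTheory.Automorphic.LocalUnitaryIntegralLevelCongr                   -- ★ `eventually_exists_cmDatumLocalCongr_levelMatching_three`
import HarnessLib

/-!
# R90-TF · S9 «InnerForm-13.3.6 (c)» — THE DATUM LAW «`πˢ(ξ_v)` IS RAMIFIED FOR ALMOST ALL `v`» PAID FOR THE A-PACKET FAMILY OF RECORD, HYPOTHESIS-FREE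
# (Rogawski 1990, §12.2 p. 173 (compact centre at non-split `v`), Prop. 13.1.3 (d) p. 199 («`πˢ(ξ)` supercuspidal»), §14.2 p. 233; Harish-Chandra 1970 Part I §3)

Cell `hodgecm-mathlib`, crux H413 (`stmt-HodgeConjecture-24833`, lane `--supports … --as helper`), route of record `HCCMUnconditional` (no route verbs; count-neutral).
Programme R90-TF (brief `director/R90-BRIEF.v2.md` 1f40d54518340a35), section S9 = InnerForm-13.3.6 (c) (base `R90-IF`); seat R90-IF-p06 (g0); self-dealt sequel (δ4) of
deal (α) (R90 bus 2026-09-04, R90-IF-p06 REPORT-FIRST (δ1)): the law binder `hPis : PisSlotsNotSphericalCofinite L H Ξ₀` of ★ `definiteAeRigidity_ofLevels` (the hypothesis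
of ★ (L) `evpRep_iff_evp_of_memPrime`, designated «S1∕S4 payer» by R90-IF-p01) is PAID here for the record `Ξ₀ := xiPacketFamilyOfRecordSCD … μZ keys hSC` and ANY
supercuspidal partner datum `hSC`.  THEOREMS ONLY (no `def`, no instance, no notation, no named-fact hypothesis, no `sorry`); imports ★ only.
HONEST LABEL: HC_CM is proved only modulo the 7 printed citations (2 remaining named inputs: hLiu418 = stmt-HodgeConjecture-24832, h413 = stmt-HodgeConjecture-24833) — until
rung 0 closes.  A classical local lemma assembled from ★ parts; no leaf moves; REL ≠ ★ ≠ BUILT.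

THE MATHEMATICS.  `PisSlotsNotSphericalCofinite L H Ξ` says: for all but finitely many finite places `v` of `L⁺`, no SECOND member `πˢ` of a packet `Ξ ξ v` is
`U(H)(𝒪_v)`-spherical.  For the record: at a SPLIT `v`, `Ξ₀ ξ v` is the D6 split packet, which has no second member (★ `cmSplitPacket_πs = none`) — vacuous; at a
NON-SPLIT `v`, `Ξ₀ ξ v = ⟨πⁿ ∘ e₀, some πˢ⟩` with `πˢ = (hSC …).1` SUPERCUSPIDAL by the datum's own certificate `(hSC …).2.1` [Prop. 13.1.3 (d)].  A supercuspidal class of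
`U(H)(L⁺_v)` transported along a level-matching frame `e : U(H)(L⁺_v) ≃ U(Φ₃)(L⁺_v)` (cofinitely many `v` admit one, ★ `eventually_exists_cmDatumLocalCongr_levelMatching_three`,
§14.2 p. 233) is supercuspidal, hence square-integrable modulo the centre — the centre of `U(Φ₃)(L⁺_v)` is COMPACT at a non-split `v` [§12.2 p. 173] (★
`local_nonsplit_compactOpen_center_of_center_le` + ★ «central ⇒ scalar» `forall_mem_center_cmLocal_eq_scalar`; Harish-Chandra «°𝓔 ⊂ 𝓔₂», ★
`IrrClass.isSquareIntegrable_of_isSupercuspidal_of_isCompact_center`) — hence NOT `U(Φ₃)(𝒪_v)`-spherical for all but finitely many non-split `v` (★ (SqNS♭)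
`squareIntegrableNotSpherical_nonsplit_cofinite`, hypothesis-free), hence `πˢ` is not `U(H)(𝒪_v)`-spherical (★ K3♭ `eventually_not_isSupercuspidal_of_isSpherical_congr_of_nonsplit`
packages exactly this transport).
* `pisSlotsNotSphericalCofinite_recordSCD` — the law, for any `hSC`.

[cite: Rogawski1990, §12.2 p. 173; §13.1 Prop. 13.1.3 (d) p. 199; §14.2 pp. 232–233; §4.13 Lemma 4.13.1 (b)] [cite: HarishChandra1970, Part I §3, p. 9] [cite: Macdonald1971, Ch. V §3]
-/

set_option autoImplicit false
-- the mandated namespace repeats `HodgeConjecture.HodgeConjecture`, as in every `Theorems/*.lean` of this sub-problem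
set_option linter.dupNamespace false

noncomputable section

open NumberField IsDedekindDomain MeasureTheory Filter
open scoped Matrix

open Literature.NumberTheory Literature.NumberTheory.Automorphic Literature.NumberTheory.Automorphic.UnitaryGroup
open Literature.NumberTheory.GaloisRepresentations
open Literature.NumberTheory.Rogawski1990

namespace Summit.HodgeConjecture.HodgeConjecture.R90.S9

open Summit.HodgeConjecture.HodgeConjecture.Cruxes.H413
open Summit.HodgeConjecture.HodgeConjecture.Cruxes.H413.F0P3XiPacketFamilyOfRecordSCD (xiPacketFamilyOfRecordSCD xiPacketFamilyOfRecordSCD_of_split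
  xiPacketFamilyOfRecordSCD_of_nonsplit)

variable (L : Type) [Field L] [NumberField L] [IsCMField L] (H : Matrix (Fin 3) (Fin 3) L)
    (hH : (H.map (cmConjRingHom L))ᵀ = H) (hHd : IsUnit H.det) (μω : HeckeCharacter L) (hμu : μω.IsUnitary)
    [∀ v : HeightOneSpectrum (𝓞 ↥(maximalRealSubfield L)), MeasurableSpace (Gqs L v ⧸ Subgroup.center (Gqs L v))]
    [∀ v : HeightOneSpectrum (𝓞 ↥(maximalRealSubfield L)), BorelSpace (Gqs L v ⧸ Subgroup.center (Gqs L v))]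
    (μZ : ∀ v : HeightOneSpectrum (𝓞 ↥(maximalRealSubfield L)), Measure (Gqs L v ⧸ Subgroup.center (Gqs L v)))
    [∀ v : HeightOneSpectrum (𝓞 ↥(maximalRealSubfield L)), (μZ v).IsHaarMeasure]
    (keys : ∀ (ξ : OneDimAutRepH L) (v : HeightOneSpectrum (𝓞 ↥(maximalRealSubfield L))),
      (∀ w : PlacesOver L v, IsCMField.complexConj L • w.1 = w.1) →
        {p : IrrClass (Gqs L v) × IrrClass (Gqs L v) //
          KeysCaseTwoLabels L v (μω.semilocalComponent L v) (torusLocalComponent L (IsCMField.complexConj L) v ξ.η)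
            (torusLocalComponent L (IsCMField.complexConj L) v ξ.ψ) p.1 p.2 ∧
          p.1.IsSquareIntegrable (μZ v) ∧ ¬ p.2.IsSquareIntegrable (μZ v)})
    (hSC : ∀ (ξ : OneDimAutRepH L) (v : HeightOneSpectrum (𝓞 ↥(maximalRealSubfield L)))
      (hns : ∀ w : PlacesOver L v, IsCMField.complexConj L • w.1 = w.1)
      (T : GL (Fin 3) (LocalRing L v)) (a : LocalRing L v) (ha : IsUnit a)
      (h : formCongr (conjLocal L (IsCMField.complexConj L) v) T (H.map (algebraMap L (LocalRing L v))) =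
        a • (Matrix.of fun i j : Fin 3 => if i.val + j.val + 1 = 3 then (1 : L) else 0).map (algebraMap L (LocalRing L v)))
      (π2 πn : IrrClass (Gqs L v)),
      KeysCaseTwoLabels L v (μω.semilocalComponent L v) (torusLocalComponent L (IsCMField.complexConj L) v ξ.η)
        (torusLocalComponent L (IsCMField.complexConj L) v ξ.ψ) π2 πn → ¬ πn.IsSquareIntegrable (μZ v) →
      {πs : IrrClass ((cmDatum L 3 H).Local v) // πs.IsSupercuspidal ∧ πs ≠ IrrClass.comap (cmDatumLocalCongr L v T ha h).symm πn})

set_option synthInstance.maxHeartbeats 400000 in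
set_option maxHeartbeats 4000000 in
/-- **«`πˢ(ξ_v)` is ramified for almost all `v`» FOR THE A-PACKET FAMILY OF RECORD** — `PisSlotsNotSphericalCofinite L H (xiPacketFamilyOfRecordSCD … μZ keys hSC)`,
hypothesis-free (any partner datum `hSC`): at a split `v` the record has no second member (★ `cmSplitPacket_πs`); at a non-split `v` off the exceptional sets of ★ (SqNS♭)
and of ★ `eventually_exists_cmDatumLocalCongr_levelMatching_three`, the second member is supercuspidal (`(hSC …).2.1`), the centre of `U(Φ₃)(L⁺_v)` is compact, and ★ K3♭
forbids a `U(H)(𝒪_v)`-spherical supercuspidal class along the level-matching frame. [cite: Rogawski1990, §12.2 p. 173; §13.1 Prop. 13.1.3 (d) p. 199; §14.2 p. 233]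
[cite: HarishChandra1970, Part I §3, p. 9] -/
theorem pisSlotsNotSphericalCofinite_recordSCD :
    InnerFormSec146.PisSlotsNotSphericalCofinite L H (xiPacketFamilyOfRecordSCD L H hH hHd μω hμu μZ keys hSC) := by
  unfold InnerFormSec146.PisSlotsNotSphericalCofinite
  filter_upwards [F0P3SqNSNonsplitConsumers.eventually_not_isSupercuspidal_of_isSpherical_congr_of_nonsplit L H
      (F0P3SqIntNotSphericalNonsplitCofinite.squareIntegrableNotSpherical_nonsplit_cofinite L),
    eventually_exists_cmDatumLocalCongr_levelMatching_three L H hH hHd] with v hK3 hLM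
  intro ξ c hc
  by_cases hs : ∃ w : PlacesOver L v, IsCMField.complexConj L • w.1 ≠ w.1
  · -- split: the D6 split packet has no second member
    rw [xiPacketFamilyOfRecordSCD_of_split L H hH hHd μω hμu μZ keys hSC ξ v hs] at hc
    cases hc
  · -- non-split: the second member is the supercuspidal partner of record
    have hns : ∀ w : PlacesOver L v, IsCMField.complexConj L • w.1 = w.1 := fun w => not_not.1 fun hw => hs ⟨w, hw⟩
    obtain ⟨T₀, a₀, ha₀, h₀, hΞ, -⟩ := xiPacketFamilyOfRecordSCD_of_nonsplit L H hH hHd μω hμu μZ keys hSC ξ v hns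
    rw [hΞ] at hc
    cases hc
    obtain ⟨T, a, ha, h, hlev⟩ := hLM hns
    -- the centre of `U(Φ₃)(L⁺_v)` is compact at the non-split `v` [§12.2 p. 173]
    have hZ : IsCompact ((Subgroup.center (Gqs L v) : Subgroup (Gqs L v)) : Set (Gqs L v)) :=
      (F0P3bLocalNonsplitCompactCenter.local_nonsplit_compactOpen_center_of_center_le L 3 (qsForm L) (isUnit_antidiagOne_det L 3) v hns
        (forall_mem_center_cmLocal_eq_scalar L (qsForm L) (antidiagOne_isHermitian L 3) (isUnit_antidiagOne_det L 3) v hns)).2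
    intro hsph
    exact hK3 hns hZ (μZ v) (cmDatumLocalCongr L v T ha h).symm hlev _ hsph
      (hSC ξ v hns T₀ a₀ ha₀ h₀ (keys ξ v hns).1.1 (keys ξ v hns).1.2 (keys ξ v hns).2.1 (keys ξ v hns).2.2.2).2.1

end Summit.HodgeConjecture.HodgeConjecture.R90.S9

end
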